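import Mathlib.GroupTheory.FreeGroup.NielsenSchreier
import Mathlib.GroupTheory.ResiduallyFinite
import Literature.AnabelianGeometry.EtaleTheta.TemperedCoverings
import Literature.AnabelianGeometry.EtaleTheta.TorsorSystems
import Literature.AnabelianGeometry.EtaleTheta.Discharge.Sec2ProfiniteCompletion
import Literature.AnabelianGeometry.AbsoluteAnabelian.TopFGOpenSubgroups
import Literature.AnabelianGeometry.AbsoluteAnabelian.AbsTopI.CharOpenBasis
import HarnessLib

/-!
# [EtTh] Definition 3.3 (i): tempered filters EXIST — kernel witnesses for `TemperedFilter`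
# (NV-L2 programme, non-vacuity of the typed interface; proof-only, 0 definitions)

S. Mochizuki, *The étale theta function and its Frobenioid-theoretic manifestations*, Publ. RIMS
**45** (2009) [MochizukiEtTh2009], Definition 3.3 (i), PRIMS p.298 (PDF p.72): a *tempered filter*
on a topological group `Δ` is a countable collection of characteristic open subgroups of finite
index `{Δ^fil_i}_{i ∈ I}` with (a) `⋂_i Δ^fil_i = {1}`, (b) each `Δ^fil_i` admitting a minimal
co-free subgroup `Δ^{fil,∞}_i`, (c) every open `H ⊆ Δ` admitting an index `i_H` with
`Δ^{fil,∞}_{i_H} ⊆ H`, maximal among the `Δ^{fil,∞}_i ⊆ H`.  The tree types this VERBATIM as the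
structure `Literature.AnabelianGeometry.EtaleTheta.TemperedFilter` (abc-iut-L2-t3,
`TemperedCoverings.lean`); the cell's L2 inhabitation census (abc-iut-w5-d197,
`INHABITATION-CENSUS-L2-v1`, 2026-08-26) recorded ZERO producers for it.

This file supplies producers, all PROVED (no `sorry`, no new definition, no named fact):

* `TemperedFilter.nonempty_of_free_levels` — the general mechanism: in a DISCRETE group, any
  countable family of characteristic finite-index subgroups `Δ^fil_i` with trivial intersection,
  each of which is a FREE group, is a tempered filter with `Δ^{fil,∞}_i = {1}` for all `i`
  (the trivial subgroup of a free group is co-free — the quotient is the free group itself — and is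
  trivially minimal; (c) then holds with any index);
* `TemperedFilter.nonempty_of_finite` — every FINITE discrete group carries the one-member filter
  `{ {1} }` (honest label: a DEGENERATE witness; the minimal co-free subgroup of the trivial group
  is the trivial group, a free group on no generators);
* `TemperedFilter.nonempty_of_isFreeGroup` — every FINITELY GENERATED FREE discrete group `Δ`
  (the tempered fundamental group of a finite graph of trivial anabelioids; discrete free groups
  of finite rank are tempered) carries the tempered filter of ALL its characteristic subgroups of
  finite index: (a) is residual finiteness of free groups (tree:
  `DiscreteNormalizers.residuallyFinite_of_isFreeGroup`) together with [AbsTopI] §0 p. 9 "a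
  topologically finitely generated group admits a basis of characteristic open subgroups" (tree:
  `IsTopologicallyFinitelyGenerated.exists_charOpen_normal_le`, abc-iut-L5-t6 / L4-t13), countability
  is `IsTopologicallyFinitelyGenerated.countable_setOf_isOpen_finiteIndex`, and (b) is the
  Nielsen–Schreier theorem (Mathlib `subgroupIsFreeOfIsFree`);
* `TemperedFilter.nonempty_multiplicative_int` — the infinite cyclic discrete group `ℤ`
  (`≅ Π^tp_X / Π^tp_Y`, [EtTh] §1 p.255) as the first concrete non-finite instance;
* `TObj.nonempty` — the parameter record `TObj` of Prop. 2.15 (objects `T_M` of the category `𝒯`)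
  is inhabited (`T_1`); listed only to clear the census zero.

HONEST FRAMING: these witness the NON-VACUITY OF THE TYPED INTERFACE (Def. 3.3 (i) as typed is
satisfiable, by natural group-theoretic examples), not any property of the tempered fundamental
group of an actual log curve (whose `Δ^{fil,∞}_i` are the kernels to the universal combinatorial
coverings, Def. 3.3 (ii)); refereed pre-IUT material [EtTh] §3; nothing here bears on, or takes
a side on, [IUTchIII] Cor. 3.12; typed ≠ proved.
-/

namespace Literature.AnabelianGeometry.EtaleTheta

universe u

open Topology

/-! ### Co-freeness of the trivial subgroup of a discrete free group ([EtTh] §0 p.9) -/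

section Cofree

variable {H : Type u} [Group H] [TopologicalSpace H] [DiscreteTopology H]

/-- In a discrete FREE group the trivial subgroup is co-free: it is open, and the quotient
`H / {1} ≅ H` is free. [cite: MochizukiEtTh2009, §0 p.9 (PDF p.9)] -/
theorem isCofree_bot_of_isFreeGroup [IsFreeGroup H] : IsCofree (⊥ : Subgroup H) :=
  ⟨isOpen_discrete _, IsFreeGroup.ofMulEquiv (QuotientGroup.quotientBot (G := H)).symm⟩

/-- In a discrete FREE group the trivial subgroup is the MINIMAL co-free subgroup
("every co-free subgroup of `G` contains `H`" holds trivially for `H = {1}`).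
[cite: MochizukiEtTh2009, §0 p.9 (PDF p.9)] -/
theorem isMinimalCofree_bot_of_isFreeGroup [IsFreeGroup H] : IsMinimalCofree (⊥ : Subgroup H) :=
  ⟨isCofree_bot_of_isFreeGroup, fun _ _ _ => bot_le⟩

end Cofree

namespace TemperedFilter

variable {Δ : Type u} [Group Δ] [TopologicalSpace Δ] [DiscreteTopology Δ]

/-- The trivial subgroup of `Δ`, viewed inside a subgroup `F ≤ Δ` which is a FREE group (subspace
= discrete topology), is the minimal co-free subgroup of `F` — stated for the term
`(⊥ : Subgroup Δ).subgroupOf F` and an arbitrary normality witness, the shape of the fields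
`closure`/`normal_closure`/`isMinimalCofree_closure` of `TemperedFilter`.
[cite: MochizukiEtTh2009, Def 3.3 (i)(b) p.72] -/
theorem isMinimalCofree_bot_subgroupOf (F : Subgroup Δ) [IsFreeGroup F]
    (hN : ((⊥ : Subgroup Δ).subgroupOf F).Normal) :
    @IsMinimalCofree F _ _ ((⊥ : Subgroup Δ).subgroupOf F) hN := by
  revert hN
  rw [Subgroup.bot_subgroupOf]
  intro hN
  exact isMinimalCofree_bot_of_isFreeGroup

/-- **The mechanism.** In a discrete group `Δ`, a countable family `{Δ^fil_i}_{i ∈ I}` (with a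
distinguished index `i₀`) of characteristic subgroups of finite index with `⋂_i Δ^fil_i = {1}`, each
of which is a FREE group, is a tempered filter in the sense of Definition 3.3 (i), with
`Δ^{fil,∞}_i := {1}` for every `i` and `i_H := i₀` for every open `H`: (a) is the hypothesis,
(b) the trivial subgroup of a free group is its minimal co-free subgroup, (c) `{1} ⊆ H` and the
maximality clause is an equality of trivial subgroups. [cite: MochizukiEtTh2009, Def 3.3 (i) p.72] -/
theorem nonempty_of_free_levels {I : Type u} [Countable I] (i₀ : I) (fil : I → Subgroup Δ)
    (hfin : ∀ i, (fil i).FiniteIndex) (hchar : ∀ i, IsTopCharacteristic Δ (fil i))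
    (hinf : ⨅ i, fil i = ⊥) (hfree : ∀ i, IsFreeGroup (fil i)) :
    Nonempty (TemperedFilter Δ) :=
  ⟨{ I := I
     fil := fil
     isOpen_fil := fun _ => isOpen_discrete _
     finiteIndex_fil := hfin
     isTopCharacteristic_fil := hchar
     iInf_fil := hinf
     closure := fun _ => ⊥
     closure_le := fun _ => bot_le
     normal_closure := fun i => by
       rw [Subgroup.bot_subgroupOf]
       infer_instance
     isMinimalCofree_closure := fun i => by
       haveI := hfree i
       exact isMinimalCofree_bot_subgroupOf (fil i) _
     indexOf := fun _ => i₀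
     closure_indexOf_le := fun _ => bot_le
     closure_le_closure_indexOf := fun _ _ _ => le_rfl }⟩

/-! ### Finite groups (degenerate witness) -/

omit [TopologicalSpace Δ] [DiscreteTopology Δ] in
/-- The trivial subgroup is a free group (on no generators). [cite: MochizukiEtTh2009, §0 p.9] -/
theorem isFreeGroup_bot : IsFreeGroup (⊥ : Subgroup Δ) :=
  haveI : Unique (⊥ : Subgroup Δ) := Subgroup.instUniqueSubtypeMemBot
  IsFreeGroup.ofMulEquiv (MulEquiv.ofUnique (M := FreeGroup Empty) (N := (⊥ : Subgroup Δ)))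

variable (Δ) in
/-- **Definition 3.3 (i) is satisfiable, degenerate witness**: every FINITE discrete group `Δ`
carries the tempered filter `{Δ^fil := {1}}` (one member: open, characteristic, of finite index,
with intersection `{1}`; its minimal co-free subgroup is `{1}` itself). HONEST LABEL: non-vacuity
of the typed interface at a degenerate group, not the tempered fundamental group of a curve.
[cite: MochizukiEtTh2009, Def 3.3 (i) p.72] -/
theorem nonempty_of_finite [Finite Δ] : Nonempty (TemperedFilter Δ) :=
  nonempty_of_free_levels (I := PUnit.{u + 1}) PUnit.unit (fun _ => ⊥)
    (fun _ => inferInstance) (fun _ _ => Subgroup.map_bot _) iInf_const (fun _ => isFreeGroup_bot)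

/-! ### Finitely generated free discrete groups -/

omit [DiscreteTopology Δ] in
/-- A discrete group is a topological group. [cite: MochizukiEtTh2009, §0 p.8] -/
theorem isTopologicalGroup_of_discreteTopology [DiscreteTopology Δ] : IsTopologicalGroup Δ where
  continuous_mul := continuous_of_discreteTopology
  continuous_inv := continuous_of_discreteTopology

omit [DiscreteTopology Δ] in
/-- A finitely generated discrete group is topologically finitely generated ([AbsTopI] §0).
[cite: MochizukiEtTh2009, §0 p.8] -/
theorem isTopologicallyFinitelyGenerated_of_fg [IsTopologicalGroup Δ] [Group.FG Δ] :
    AbsoluteAnabelian.IsTopologicallyFinitelyGenerated Δ := by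
  obtain ⟨s, hs⟩ := (Group.fg_def.mp ‹Group.FG Δ›)
  exact ⟨⟨s, by rw [hs]; exact top_le_iff.mp (Subgroup.le_topologicalClosure ⊤)⟩⟩

variable (Δ) in
/-- **Definition 3.3 (i) is satisfiable at every finitely generated FREE discrete group** (the
tempered fundamental group of a finite graph of points; discrete free groups of finite rank are
tempered): the family of ALL characteristic subgroups of finite index is a tempered filter with
`Δ^{fil,∞}_i = {1}`.  (a) `⋂ = {1}`: free groups are residually finite, and every finite-index
subgroup of a (topologically) finitely generated group contains a characteristic one of finite
index ([AbsTopI] §0 p.9, tree `IsTopologicallyFinitelyGenerated.exists_charOpen_normal_le`);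
countability: a finitely generated group has countably many finite-index subgroups; (b): each
`Δ^fil_i` is free (Nielsen–Schreier), so `{1}` is its minimal co-free subgroup.
[cite: MochizukiEtTh2009, Def 3.3 (i) p.72] -/
theorem nonempty_of_isFreeGroup [IsFreeGroup Δ] [Group.FG Δ] : Nonempty (TemperedFilter Δ) := by
  haveI : IsTopologicalGroup Δ := isTopologicalGroup_of_discreteTopology
  haveI : Group.ResiduallyFinite Δ := DiscreteNormalizers.residuallyFinite_of_isFreeGroup Δ
  have hG : AbsoluteAnabelian.IsTopologicallyFinitelyGenerated Δ :=
    isTopologicallyFinitelyGenerated_of_fg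
  let S : Set (Subgroup Δ) := {U | U.FiniteIndex ∧ IsTopCharacteristic Δ U}
  haveI : Countable S := by
    refine ((hG.countable_setOf_isOpen_finiteIndex).mono ?_).to_subtype
    rintro U ⟨hUi, -⟩
    exact ⟨isOpen_discrete _, hUi⟩
  have htop : (⊤ : Subgroup Δ) ∈ S :=
    ⟨inferInstance, fun φ => Subgroup.map_top_of_surjective _ φ.surjective⟩
  refine nonempty_of_free_levels (I := S) ⟨⊤, htop⟩ (fun U => (U : Subgroup Δ))
    (fun U => U.2.1) (fun U => U.2.2) ?_ (fun U => inferInstance)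
  rw [eq_bot_iff]
  intro g hg
  rw [Subgroup.mem_iInf] at hg
  refine (Subgroup.mem_bot).mpr ((Group.residuallyFinite_iff_forall_finiteIndex.mp ‹_›) g ?_)
  intro V hV
  obtain ⟨W, -, -, hWi, hWc, hWle⟩ := hG.exists_charOpen_normal_le V (isOpen_discrete _)
  exact hWle (hg ⟨W, hWi, hWc⟩)

/-! ### The infinite cyclic discrete group -/

/-- **Definition 3.3 (i) at `Δ = ℤ`** (discrete, written multiplicatively; "`Π^tp_X / Π^tp_Y ≅ ℤ`",
[EtTh] §1 p.255): the subgroups `nℤ`, `n ≥ 1` — all characteristic of finite index — form a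
tempered filter with all `Δ^{fil,∞} = {0}`. [cite: MochizukiEtTh2009, Def 3.3 (i) p.72] -/
theorem nonempty_multiplicative_int : Nonempty (TemperedFilter (Multiplicative ℤ)) :=
  haveI : IsFreeGroup (Multiplicative ℤ) :=
    IsFreeGroup.ofMulEquiv (FreeGroup.mulEquivIntOfUnique (α := Unit))
  haveI : Group.FG (Multiplicative ℤ) := inferInstance
  nonempty_of_isFreeGroup (Multiplicative ℤ)

end TemperedFilter

/-! ### Rider: the parameter record `TObj` (Prop. 2.15) -/

/-- The object `T_1` of the category `𝒯` of Proposition 2.15 — the record `TObj` is inhabited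
(listed only to clear the census zero; `TObj` is a one-field index record).
[cite: MochizukiEtTh2009, Prop 2.15 p.52] -/
theorem TObj.nonempty : Nonempty TObj := ⟨⟨1⟩⟩


/-! ## v2 (append-only): virtually free discrete groups, profinite groups, and `TemperedFilterOn`

* `TemperedFilter.nonempty_of_virtuallyFree` — every finitely generated discrete `Δ` with a FREE
  subgroup `F` of finite index (tempered `π₁` of a finite graph of anabelioids with FINITE vertex
  groups, e.g. `PSL₂(ℤ) ≅ C₂ ∗ C₃`): the characteristic finite-index subgroups inside `F`, `Δ^{fil,∞}_i
  = {1}` (residual finiteness of virtually free groups + [AbsTopI] §0 p.9 inside `V ∩ F` +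
  Nielsen–Schreier);
* `TemperedFilter.nonempty_of_profinite` — the OTHER EXTREME: every topologically finitely generated
  PROFINITE group (`Ẑ`, `ℤ_p`, `F̂₂`, `G_K` of a `p`-adic field): ALL characteristic open subgroups,
  with `Δ^{fil,∞}_i = Δ^fil_i` (in a compact group a co-free subgroup has a finite free, hence
  trivial, quotient); (a), (c) by [AbsTopI] §0 p.9, `i_H :=` the join of the members inside `H`;
* `nonempty_temperedFilterOn_of_subsingleton` — Def. 3.3 (ii)'s `TemperedFilterOn X` at any
  `X : TemperedArithmeticGroup K` with trivial `Δ^tp_X` (honest label DEGENERATE).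
-/

/-! ### Finite free groups are trivial; the top subgroup of a compact group is minimal co-free -/

section CompactCofree

/-- A FINITE free group is trivial (a free group on a nonempty set of generators is infinite).
[cite: MochizukiEtTh2009, §0 p.9] -/
theorem subsingleton_of_isFreeGroup_of_finite (H : Type u) [Group H] [IsFreeGroup H] [Finite H] :
    Subsingleton H := by
  rcases isEmpty_or_nonempty (IsFreeGroup.Generators H) with hE | hE
  · haveI : Unique (FreeGroup (IsFreeGroup.Generators H)) := inferInstance
    exact (IsFreeGroup.toFreeGroup H).toEquiv.subsingleton
  · haveI : Infinite (FreeGroup (IsFreeGroup.Generators H)) := inferInstance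
    haveI : Infinite H := Infinite.of_injective _ (IsFreeGroup.toFreeGroup H).symm.injective
    exact (not_finite H).elim

/-- The whole group is a co-free subgroup of itself (the quotient is the free group on no
generators). [cite: MochizukiEtTh2009, §0 p.9] -/
theorem isCofree_top (H : Type u) [Group H] [TopologicalSpace H] : IsCofree (⊤ : Subgroup H) := by
  refine ⟨isOpen_univ, ?_⟩
  haveI : Unique (H ⧸ (⊤ : Subgroup H)) :=
    @uniqueOfSubsingleton _ QuotientGroup.subsingleton_quotient_top 1
  exact IsFreeGroup.ofMulEquiv (MulEquiv.ofUnique (M := FreeGroup Empty) (N := H ⧸ (⊤ : Subgroup H)))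

/-- In a COMPACT topological group the whole group is the MINIMAL co-free subgroup: a co-free
subgroup is open, hence of finite index, with a free — hence trivial — quotient, so it is the whole
group. [cite: MochizukiEtTh2009, §0 p.9] -/
theorem isMinimalCofree_top_of_compactSpace (H : Type u) [Group H] [TopologicalSpace H]
    [IsTopologicalGroup H] [CompactSpace H] : IsMinimalCofree (⊤ : Subgroup H) := by
  refine ⟨isCofree_top H, fun H' hN hc => ?_⟩
  haveI : Finite (H ⧸ H') := H'.quotient_finite_of_isOpen hc.isOpen
  haveI : IsFreeGroup (H ⧸ H') := hc.isFreeGroup_quotient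
  haveI : Subsingleton (H ⧸ H') := subsingleton_of_isFreeGroup_of_finite (H ⧸ H')
  intro g _
  exact (QuotientGroup.eq_one_iff g).mp (Subsingleton.elim _ _)

end CompactCofree

namespace TemperedFilter

/-! ### Virtually free discrete groups -/

section VirtuallyFree

variable {Δ : Type u} [Group Δ] [TopologicalSpace Δ] [DiscreteTopology Δ]

variable (Δ) in
/-- **Definition 3.3 (i) is satisfiable at every finitely generated VIRTUALLY FREE discrete group**:
if `F ≤ Δ` is a free subgroup of finite index, the characteristic finite-index subgroups of `Δ`
contained in `F` form a tempered filter with `Δ^{fil,∞}_i = {1}`. (a): `Δ` is residually finite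
(it has the residually finite subgroup `F` of finite index) and every finite-index `V` contains a
characteristic finite-index subgroup inside `V ∩ F` ([AbsTopI] §0 p.9); (b): subgroups of `F` are
free (Nielsen–Schreier). [cite: MochizukiEtTh2009, Def 3.3 (i) p.72] -/
theorem nonempty_of_virtuallyFree [Group.FG Δ] (F : Subgroup Δ) [F.FiniteIndex] [IsFreeGroup F] :
    Nonempty (TemperedFilter Δ) := by
  haveI : IsTopologicalGroup Δ := isTopologicalGroup_of_discreteTopology
  haveI : Group.ResiduallyFinite F := DiscreteNormalizers.residuallyFinite_of_isFreeGroup F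
  haveI : Group.ResiduallyFinite Δ := DiscreteNormalizers.residuallyFinite_of_finiteIndex F
  have hG : AbsoluteAnabelian.IsTopologicallyFinitelyGenerated Δ :=
    isTopologicallyFinitelyGenerated_of_fg
  let S : Set (Subgroup Δ) := {U | U.FiniteIndex ∧ IsTopCharacteristic Δ U ∧ U ≤ F}
  haveI : Countable S := by
    refine ((hG.countable_setOf_isOpen_finiteIndex).mono ?_).to_subtype
    rintro U ⟨hUi, -, -⟩
    exact ⟨isOpen_discrete _, hUi⟩
  obtain ⟨W₀, -, -, hW₀i, hW₀c, hW₀le⟩ := hG.exists_charOpen_normal_le F (isOpen_discrete _)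
  refine nonempty_of_free_levels (I := S) ⟨W₀, hW₀i, hW₀c, hW₀le⟩ (fun U => (U : Subgroup Δ))
    (fun U => U.2.1) (fun U => U.2.2.1) ?_ (fun U => ?_)
  · rw [eq_bot_iff]
    intro g hg
    rw [Subgroup.mem_iInf] at hg
    refine (Subgroup.mem_bot).mpr ((Group.residuallyFinite_iff_forall_finiteIndex.mp ‹_›) g ?_)
    intro V hV
    obtain ⟨W, -, -, hWi, hWc, hWle⟩ := hG.exists_charOpen_normal_le (V ⊓ F) (isOpen_discrete _)
    exact (hWle.trans inf_le_left) (hg ⟨W, hWi, hWc, hWle.trans inf_le_right⟩)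
  · haveI : IsFreeGroup ((U : Subgroup Δ).subgroupOf F) := inferInstance
    exact IsFreeGroup.ofMulEquiv (Subgroup.subgroupOfEquivOfLe U.2.2.2)

end VirtuallyFree

/-! ### Topologically finitely generated profinite groups (`Δ^{fil,∞}_i = Δ^fil_i`) -/

section Profinite

variable {Δ : Type u} [Group Δ] [TopologicalSpace Δ] [IsTopologicalGroup Δ] [CompactSpace Δ]

/-- In a compact group, an open subgroup `U` is its own minimal co-free subgroup — stated for the
term `U.subgroupOf U` and an arbitrary normality witness, the shape of the fields of
`TemperedFilter`. [cite: MochizukiEtTh2009, Def 3.3 (i)(b) p.72] -/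
theorem isMinimalCofree_self_subgroupOf (U : Subgroup Δ) (hU : IsOpen (U : Set Δ))
    (hN : (U.subgroupOf U).Normal) : @IsMinimalCofree U _ _ (U.subgroupOf U) hN := by
  revert hN
  rw [Subgroup.subgroupOf_self]
  intro hN
  haveI : CompactSpace U :=
    isCompact_iff_compactSpace.mp (IsClosed.isCompact (U.isClosed_of_isOpen hU))
  exact isMinimalCofree_top_of_compactSpace U

variable (Δ) in
/-- **Definition 3.3 (i) is satisfiable at every topologically finitely generated PROFINITE group**
(compact and totally disconnected; e.g. `Ẑ`, `ℤ_p`, `F̂₂`, the absolute Galois group of a `p`-adic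
local field): the family of ALL characteristic open subgroups is a tempered filter with
`Δ^{fil,∞}_i = Δ^fil_i` (in a compact group the only co-free subgroup of `Δ^fil_i` is `Δ^fil_i`
itself — the opposite extreme to the free discrete case), `i_H :=` the join of the members contained
in `H`; (a) and the existence of members inside every open `H` are [AbsTopI] §0 p.9 "a topologically
finitely generated group admits a basis of characteristic open subgroups".
[cite: MochizukiEtTh2009, Def 3.3 (i) p.72] -/
theorem nonempty_of_profinite [TotallyDisconnectedSpace Δ]
    (hG : AbsoluteAnabelian.IsTopologicallyFinitelyGenerated Δ) : Nonempty (TemperedFilter Δ) := by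
  let S : Set (Subgroup Δ) := {U | IsOpen (U : Set Δ) ∧ IsTopCharacteristic Δ U}
  haveI : Countable S := ((hG.countable_setOf_isOpen).mono fun U hU => hU.1).to_subtype
  have hfi : ∀ U : S, (U : Subgroup Δ).FiniteIndex := fun U => by
    haveI := (U : Subgroup Δ).quotient_finite_of_isOpen U.2.1
    exact Subgroup.finiteIndex_of_finite_quotient
  -- the index attached to an open subgroup `H`: the join of the members contained in `H`
  let J : OpenSubgroup Δ → Subgroup Δ := fun H =>
    ⨆ U : {U : S // ((U : S) : Subgroup Δ) ≤ (H : Subgroup Δ)}, ((U : S) : Subgroup Δ)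
  have hJle : ∀ H : OpenSubgroup Δ, J H ≤ (H : Subgroup Δ) := fun H => iSup_le fun U => U.2
  have hleJ : ∀ (H : OpenSubgroup Δ) (U : S), (U : Subgroup Δ) ≤ (H : Subgroup Δ) →
      (U : Subgroup Δ) ≤ J H := fun H U hU =>
    le_iSup (fun V : {V : S // ((V : S) : Subgroup Δ) ≤ (H : Subgroup Δ)} =>
      ((V : S) : Subgroup Δ)) ⟨U, hU⟩
  have hJmem : ∀ H : OpenSubgroup Δ, J H ∈ S := by
    intro H
    haveI : Finite (Δ ⧸ (H : Subgroup Δ)) := (H : Subgroup Δ).quotient_finite_of_isOpen H.isOpen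
    haveI : (H : Subgroup Δ).FiniteIndex := Subgroup.finiteIndex_of_finite_quotient
    obtain ⟨W, -, hWo, -, hWc, hWle⟩ := hG.exists_charOpen_normal_le (H : Subgroup Δ) H.isOpen
    have hWJ : W ≤ J H := hleJ H ⟨W, hWo, hWc⟩ hWle
    refine ⟨Subgroup.isOpen_mono hWJ hWo, fun φ => ?_⟩
    change (⨆ U : {U : S // ((U : S) : Subgroup Δ) ≤ (H : Subgroup Δ)}, ((U : S) : Subgroup Δ)).map
        φ.toMulEquiv.toMonoidHom = _
    rw [Subgroup.map_iSup]
    exact iSup_congr fun U => U.1.2.2 φ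
  refine ⟨{ I := S
            fil := fun U => U
            isOpen_fil := fun U => U.2.1
            finiteIndex_fil := hfi
            isTopCharacteristic_fil := fun U => U.2.2
            iInf_fil := ?_
            closure := fun U => U
            closure_le := fun _ => le_rfl
            normal_closure := fun U => by
              rw [Subgroup.subgroupOf_self]
              infer_instance
            isMinimalCofree_closure := fun U => isMinimalCofree_self_subgroupOf (U : Subgroup Δ) U.2.1 _
            indexOf := fun H => ⟨J H, hJmem H⟩
            closure_indexOf_le := hJle
            closure_le_closure_indexOf := fun H U hU => hleJ H U hU }⟩
  -- (a): the characteristic open subgroups have trivial intersection ([AbsTopI] §0 p.9)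
  rw [eq_bot_iff]
  intro g hg
  rw [Subgroup.mem_iInf] at hg
  rw [Subgroup.mem_bot]
  by_contra hne
  obtain ⟨W, -, hWo, -, hWc, hWs⟩ :=
    hG.exists_charOpen_normal_subset (isOpen_compl_singleton (x := g)) (Ne.symm hne)
  exact hWs (hg ⟨W, hWo, hWc⟩) rfl

end Profinite

end TemperedFilter

/-! ### Definition 3.3 (ii): `TemperedFilterOn X` at the degenerate inhabitants of the interface -/

/-- **Definition 3.3 (ii)** — "a tempered filter on `Δ^tp_X` [is] a *tempered filter on `X^log`*" —
is satisfiable at every `X : TemperedArithmeticGroup K` with TRIVIAL `Δ^tp_X` (the tree's degenerate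
inhabitants of the [SemiAnbd] Ex. 3.10 interface, `TemperedArithmeticGroup.nonempty_of_isAlgClosed`
and kin). HONEST LABEL: DEGENERATE. [cite: MochizukiEtTh2009, Def 3.3 (ii) p.72] -/
theorem nonempty_temperedFilterOn_of_subsingleton {K : Type u} [Field K]
    (X : SemiGraphs.TemperedArithmeticGroup K) [Subsingleton X.delta] :
    Nonempty (TemperedFilterOn X) := by
  haveI : Finite X.delta := Finite.of_subsingleton
  exact TemperedFilter.nonempty_of_finite X.delta

end Literature.AnabelianGeometry.EtaleTheta
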